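import Literature.AlgebraicGeometry.AbelianSchemes.AbelianSchemeKOfLFlat
import HarnessLib

/-!
# F-3 sub-line `Cruxes/HDel/Lines/F3DualAbelianScheme` — stub (K) `stub_F3K` CLOSED: `K(L)` is finite étale over a Noetherian affine `ℚ`-base

Summit `HodgeConjecture`, sub-problem `HodgeConjecture` (crux item `stmt-HodgeConjecture-24835`, HDel), namespace
`Summit.HodgeConjecture.CorCM.Cruxes.HypDel.F3DualAbelianScheme` (the registered skeleton's).  `stub_F3K_holds` is the letter of
`stub_F3K` (`Cruxes/HDel/Lines/F3DualAbelianScheme.lean` :109) TOKEN FOR TOKEN, proved by ★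
`Literature.AlgebraicGeometry.AbelianSchemes.AbelianSchemeOver.exists_kOfL_etale` (road T of the (K) census: torsion rigidity of
`Ȟ¹(𝒪^×)` along nilpotent thickenings ★ (T2), `i ^ n = 1` and `K(L) ⊆ A[n]` ★ (T3)(T4), the open-immersion criterion ★ (T5), assembly ★ (T6)).
Cell `hodgecm-mathlib` (D-0151); author B-p08 (g15).  HC_CM is proved only modulo the 7 printed citations until rung 0 closes; this
file discharges none of them (it closes one registered stub of the F-3 sub-line of the P1 line under HDel).
-/

noncomputable section

open CategoryTheory CategoryTheory.Limits AlgebraicGeometry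
open Literature.AlgebraicGeometry.AbelianSchemes Literature.AlgebraicGeometry.Motives
  Literature.AlgebraicGeometry.AbelianVarieties Literature.AlgebraicGeometry.Modules

namespace Summit.HodgeConjecture.CorCM.Cruxes.HypDel.F3DualAbelianScheme

/-- **stub (K) `stub_F3K` PROVED** — «`K(L)` IS FINITE ÉTALE OVER THE BASE» for an abelian scheme over a Noetherian affine `ℚ`-base
`Spec R` (`R` arbitrary: neither a domain nor reduced) and `L` of rank one rigidified along the identity section and fibrewise of
the class of an ample divisor: the closed subscheme representing `K(L)` is finite and ÉTALE over `Spec R` (★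
`AbelianSchemeOver.exists_kOfL_etale`).  Statement = `stub_F3K` of the registered skeleton, token for token.
[cite: MumfordAV1970, §13 (p. 123)] [cite: MumfordFogartyKirwan1994, Ch. 6 §2 Prop. 6.13 (iii) (p. 123)]
[cite: GortzWedhorn2023, Prop. 27.187 and Cor. 27.63] -/
theorem stub_F3K_holds : ∀ (R : Type) [CommRing R] [IsNoetherianRing R] [Algebra ℚ R] (A : AbelianSchemeOver (Spec (.of R)))
    (L : A.left.Modules) (hL : HasRank L 1)
    (_hε : CechPic.pullback A.unitSection (detClass (HasRank.isFiniteLocallyFree' hL)) = 1)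
    (_hΘ : ∀ ⦃Ω : Type⦄ [Field Ω] [IsAlgClosed Ω] (s : Spec (.of Ω) ⟶ Spec (.of R)),
      ∃ Θ : CartierDivisor (A.fibre s).toAbelianVariety.X.left, Θ.IsAmple ∧
        CechPic.pullback (X := (A.fibre s).toAbelianVariety.X.left) (pullback.fst A.X.hom s)
          (detClass (HasRank.isFiniteLocallyFree' hL)) = Θ.cechClass),
    ∃ (Z : Over (Spec (.of R))) (i : Z ⟶ A.X) (_ : IsClosedImmersion i.left) (_ : IsFinite Z.hom) (_ : Etale Z.hom),
      ∀ (T : Over (Spec (.of R))) (u : T ⟶ A.X), (∃ v : T ⟶ Z, v ≫ i = u) ↔ A.MemKOfL L u :=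
  fun _R _ _ _ A _L hL hε hΘ => A.exists_kOfL_etale hL hε hΘ

end Summit.HodgeConjecture.CorCM.Cruxes.HypDel.F3DualAbelianScheme

end
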